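import Summits.QuantumFields.YangMills.Theorems.AlphaInputsT3ACv3Data
import Summits.QuantumFields.YangMills.Theorems.AlphaInputsT3ACv2RecHistories
import HarnessLib

/-!
# `AlphaInputsT3ACv3Histories` — THE v3 DATUM'S HISTORY SUM: the windowed pinned weights' clauses (w0)/(w1)/(w2)/(e′)/(e″), the interface's `LFData`/`LFSum`,
# the geometric half of `LargePSpec`, and **v5p5's STUB 2‴ `stub_windowedWeights` (crux `HistoryTailL` = stmt-QuantumFields-19936) AS A THEOREM FOR THE v3
# SOCKET** (owner RULING g18-№3 §3 (iv)) — lane `pub-balaban3d`, seat alpha-1 (g3)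

WHAT IS PROVED (given only `h : OfV3At F 𝔠 a₀ a₁`, the OPEN v3 hypothesis schema; nothing of [Balaban1985UV3] is asserted):
* §1 for the weights `wtP_j(r, ·)` of `OfV3At.dataT3v3` (`PkgAtV3.wtP`: `1` at `j = 0`; `𝟙[(40)-window_{k+1}(r)]·M_{k+1}(r)` at `j = k + 1`, `M` the PINNED masses):
  (w0) `wtP ≥ 0`; (w1) `wtP = 0` on inadmissible histories; (w2) `wtP_j(r, W) ≠ 0 ⇒ Adm K j r W` for `1 ≤ j ≤ K`, EVERY history `r`, POINTWISE (at `j = 0` print has no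
  characteristic function — (1) p.256 — and `Hist 0 = {triv}`: seat finding F-α1-9); (e′) `Integrable (wtP_j r) ∧ ∫ wtP_j(r, ·) ≤ 1` for ALL `K, j, r` — uniform in the
  cut-off (`MassesPAC.integral_massRecP_le_one`: `T_k 1 = 1` a.e. under `AvgAC`, no floor to compound); (e″) `Pint_j(r, ·)` measurable, `j ≤ K`.
* §2 `OfV3At.dataT3v3P` := `dataT3v3` with `LF` written as the stub writes it (`wt′(triv)·e^{Φ triv} + Σ_{r ≠ triv} wt′(r)·e^{Φ r}`) — the same function
  (`Finset.add_sum_erase`), hence `Ineq41AE` and `Integrable up` at every `j ≤ K` for it too.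
* §3 `OfV3At.lfDataT3v3` (region histories the lane's, dummy fibre variable, `wt := wtP`, `LargeP r i := P_i(r)` for admissible `r`, `i < j`) with `LFSum` PROVED and
  the geometric half of `LargePSpec` PROVED (`lfDataT3v3_largeP_geom`).
* §4 **`AlphaInputsT3AC.windowedWeights_v3`**: v5p5's `stub_windowedWeights` text with `OfV2At ↦ OfV3At`, `dataT3c ↦ dataT3v3`, the (w2) guard `1 ≤ j`, witnessed by
  `wt′ := wtP`, `γw := 1`, `Bm := 1` — UNCONDITIONAL given `h : OfV3At`.

References: T. Bałaban, Commun. Math. Phys. 102 (1985) 255–275 [Balaban1985UV3] ((1) p.256, (38)–(41) p.266, (47) p.267, (55) p.269, (67) p.273, Thm 2 p.272).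
-/

set_option autoImplicit false

noncomputable section

namespace Summit.QuantumFields.YangMills.Theorems

open MeasureTheory
open scoped BigOperators
open Literature.MathematicalPhysics.QuantumFieldTheory.Balaban1983to89
open Literature.MathematicalPhysics.QuantumFieldTheory.Balaban1983to89.T3ContinuumYM3Torus
open Literature.MathematicalPhysics.QuantumFieldTheory.Balaban1983to89.T3UnitLawDensityEML (ℰp)
open Literature.MathematicalPhysics.QuantumFieldTheory.Balaban1983to89.T3UnitScaleTilt (θBal)
open Literature.MathematicalPhysics.QuantumFieldTheory.Balaban1983to89.T3AlphaInputsAC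
open Literature.MathematicalPhysics.QuantumFieldTheory.Balaban1983to89.T3AlphaInputsACSchemas
open Literature.MathematicalPhysics.QuantumFieldTheory.Balaban1983to89.B10Eq38TorusDomains (toFine cornerSet plaqsIn mem_plaqsIn_iff)
open Literature.MathematicalPhysics.QuantumFieldTheory.Balaban1983to89.B10Eq42TorusConstraint (lam42 lam42_of_lt)
open Literature.MathematicalPhysics.QuantumFieldTheory.Balaban1985CMP102
open Literature.MathematicalPhysics.QuantumFieldTheory.Balaban1985CMP102.Setting
open Summit.QuantumFields.Balaban3D.Carriers
open Summit.QuantumFields.Balaban3D.Proofs.Primitives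
open Summit.QuantumFields.Balaban3D.Proofs.TowerAC
open Summit.QuantumFields.Balaban3D.Proofs.StandardAC
open Summit.QuantumFields.Balaban3D.Proofs.InputsAC

open Classical

variable {F : T3Family} {𝔠 : AlphaConsts F.L (suGroupModel 2).N} {a₀ a₁ : ℝ}
  (h : AlphaInputsT3AC.OfV3At F 𝔠 a₀ a₁) (hc : 0 < a₀ ∧ 0 < a₁ ∧ 𝔠.B₃ * a₁ ≤ a₀) (γ : ℝ) (hγ : 0 < γ)
  (hγ1 : γ ≤ (min 𝔠.gamma0 1) ^ 2) (π : AlphaInputsT3AC.PolymerT3 F)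

/-! ## §1 The clauses of the windowed pinned weights -/

/-- (w0) `wtP ≥ 0`. [folklore] -/
theorem AlphaInputsT3AC.OfV3At.wtP_nonneg (K j : ℕ) (r : Hist (F.P K) j) (W : GaugeField (F.P K) j (Matrix.specialUnitaryGroup (Fin 2) ℂ)) :
    0 ≤ (h.pkgAtV3 hc γ hγ hγ1 K).wtP j r W :=
  (PinnedStep.wtP_nonneg_le 𝔠.lane (h.pkgAtV3 hc γ hγ hγ1 K).X (AlphaInputsT3AC.admWindowT3 F 𝔠 γ hγ hγ1 K) j r W).1

/-- (w1) `wtP = 0` on inadmissible histories. [folklore] -/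
theorem AlphaInputsT3AC.OfV3At.wtP_eq_zero_of_not_admissible (K j : ℕ) (r : Hist (F.P K) j)
    (W : GaugeField (F.P K) j (Matrix.specialUnitaryGroup (Fin 2) ℂ))
    (hr : ¬ Hist.Admissible 𝔠.lane.carrier.M₁
      (rcolOf (T3Scales F γ hγ (hγ1.trans (sq_min_one_le _ 𝔠.gamma0_pos)) K) 𝔠.lane.carrier) j r) :
    (h.pkgAtV3 hc γ hγ hγ1 K).wtP j r W = 0 :=
  PinnedStep.wtP_eq_zero_of_not_admissible 𝔠.lane (h.pkgAtV3 hc γ hγ hγ1 K).X (AlphaInputsT3AC.admWindowT3 F 𝔠 γ hγ hγ1 K) j r W hr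

/-- **(w2) SUPPORT IN `Adm`, EVERY HISTORY, `1 ≤ j ≤ K`, POINTWISE**: `wtP_j(r, W) ≠ 0 ⇒ Adm K j r W` for the v3 datum (`Adm = ChargedT3`: `r` admissible and `W` in
the (40) window under `Ω_j(r)` — the window sits INSIDE the weight). [cite: Balaban1985UV3, (40)–(41) p.266] -/
theorem AlphaInputsT3AC.OfV3At.adm_of_wtP_ne_zero (K j : ℕ) (hj1 : 1 ≤ j) (hj : j ≤ K) (r : Hist (F.P K) j)
    (W : GaugeField (F.P K) j (Matrix.specialUnitaryGroup (Fin 2) ℂ)) (hW : (h.pkgAtV3 hc γ hγ hγ1 K).wtP j r W ≠ 0) :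
    (h.dataT3v3 hc γ hγ hγ1 π).Adm K j r W := by
  obtain ⟨k, rfl⟩ : ∃ k, j = k + 1 := ⟨j - 1, by omega⟩
  obtain ⟨hmem, hadm⟩ := PinnedStep.mem_of_wtP_succ_ne_zero 𝔠.lane (h.pkgAtV3 hc γ hγ hγ1 K).X (AlphaInputsT3AC.admWindowT3 F 𝔠 γ hγ hγ1 K) k r W hW
  refine ⟨hadm, ?_⟩
  have hKk : K - (k + 1) + 1 = K - k := by omega
  rw [hKk]
  exact hmem

/-- **(e′) `wtP_j(r, ·)` IS INTEGRABLE WITH `∫ ≤ 1`, ALL `K, j, r` — UNIFORM IN THE CUT-OFF** (`PinnedStep.integrable_wtP_and_integral_le`). [cite: Balaban1985UV3, (41) p.266 + (48) p.267] -/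
theorem AlphaInputsT3AC.OfV3At.integrable_wtP_and_integral_le (K j : ℕ) (r : Hist (F.P K) j) :
    Integrable ((h.pkgAtV3 hc γ hγ hγ1 K).wtP j r) (fieldMeasure (F.P K) j (Matrix.specialUnitaryGroup (Fin 2) ℂ)) ∧
      ∫ W, (h.pkgAtV3 hc γ hγ hγ1 K).wtP j r W ∂fieldMeasure (F.P K) j (Matrix.specialUnitaryGroup (Fin 2) ℂ) ≤ 1 :=
  PinnedStep.integrable_wtP_and_integral_le 𝔠.lane (h.pkgAtV3 hc γ hγ hγ1 K).X (AlphaInputsT3AC.admWindowT3 F 𝔠 γ hγ hγ1 K)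
    (AlphaInputsT3AC.measurableSet_admWindowT3 F 𝔠 γ hγ hγ1 K) j r

/-- (e″) `Pint_j(r, ·)` of the v3 datum is measurable for `j ≤ K` (data rows below the top, terminal row at the top). [cite: Balaban1985UV3, (43) p.266] -/
theorem AlphaInputsT3AC.OfV3At.dataT3v3_measurable_Pint (K j : ℕ) (hj : j ≤ K) (r : Hist (F.P K) j) :
    Measurable fun W : GaugeField (F.P K) j (Matrix.specialUnitaryGroup (Fin 2) ℂ) => (h.dataT3v3 hc γ hγ hγ1 π).Pint K j r W :=
  (h.pkgAtV3 hc γ hγ hγ1 K).measurable_Pint j hj r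

/-! ## §2 The datum with `LF` written as the stub writes it -/

/-- **THE v3 DATUM WITH `LF` SPLIT AT THE TRIVIAL HISTORY** (structure update of `dataT3v3`, v5p5's STUB 2‴ shape with `wt′ := wtP`): the same function as `dataT3v3.LF`.
[cite: Balaban1985UV3, (41) p.266] -/
def AlphaInputsT3AC.OfV3At.dataT3v3P : AlphaDataT3 F γ :=
  { h.dataT3v3 hc γ hγ hγ1 π with
    LF := fun K j Wf Φ => (h.pkgAtV3 hc γ hγ hγ1 K).wtP j (Hist.triv (F.P K) j) Wf * Real.exp (Φ (Hist.triv (F.P K) j)) +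
      ∑ r ∈ Finset.univ.erase (Hist.triv (F.P K) j), (h.pkgAtV3 hc γ hγ hγ1 K).wtP j r Wf * Real.exp (Φ r) }

/-- The majorant of `dataT3v3P` is that of `dataT3v3` (`Finset.add_sum_erase`). [folklore] -/
theorem AlphaInputsT3AC.OfV3At.dataT3v3P_up_eq (K j : ℕ) (W : GaugeField (F.P K) j (Matrix.specialUnitaryGroup (Fin 2) ℂ)) :
    (h.dataT3v3P hc γ hγ hγ1 π).up K j W = (h.dataT3v3 hc γ hγ hγ1 π).up K j W := by
  show (h.pkgAtV3 hc γ hγ hγ1 K).wtP j (Hist.triv (F.P K) j) W * Real.exp _ +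
      ∑ r ∈ Finset.univ.erase (Hist.triv (F.P K) j), (h.pkgAtV3 hc γ hγ hγ1 K).wtP j r W * Real.exp _ =
    ∑ r : Hist (F.P K) j, (h.pkgAtV3 hc γ hγ hγ1 K).wtP j r W * Real.exp _
  exact Finset.add_sum_erase Finset.univ (fun r => (h.pkgAtV3 hc γ hγ hγ1 K).wtP j r W *
    Real.exp (-((h.dataT3v3 hc γ hγ hγ1 π).mainT K j r W) + (h.dataT3v3 hc γ hγ hγ1 π).Pint K j r W + (h.dataT3v3 hc γ hγ hγ1 π).Zterm K j r))
    (Finset.mem_univ _)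

/-- **(iv) `Ineq41AE` for `dataT3v3P`, every `j ≤ K`.** [cite: Balaban1985UV3, (41) p.266 and Thm 2 p.272] -/
theorem AlphaInputsT3AC.OfV3At.dataT3v3P_ineq41AE (K j : ℕ) (hj : j ≤ K) : Ineq41AE (h.dataT3v3P hc γ hγ hγ1 π) K j := by
  unfold Ineq41AE
  filter_upwards [h.dataT3v3_ineq41AE hc γ hγ hγ1 π K j hj] with W hW
  rw [h.dataT3v3P_up_eq hc γ hγ hγ1 π K j W]
  exact hW

/-- **(iv) `up_{dataT3v3P}` integrable, every `j ≤ K`.** [folklore] -/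
theorem AlphaInputsT3AC.OfV3At.dataT3v3P_integrable_up (K j : ℕ) (hj : j ≤ K) :
    Integrable ((h.dataT3v3P hc γ hγ hγ1 π).up K j) (fieldMeasure (F.P K) j (Matrix.specialUnitaryGroup (Fin 2) ℂ)) := by
  have hfun : (h.dataT3v3P hc γ hγ hγ1 π).up K j = (h.dataT3v3 hc γ hγ hγ1 π).up K j := funext fun W => h.dataT3v3P_up_eq hc γ hγ hγ1 π K j W
  rw [hfun]
  exact h.dataT3v3_integrable_up hc γ hγ hγ1 π K j hj

/-! ## §3 The interface's `LFData`, `LFSum`, and the geometric half of `LargePSpec` -/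

/-- **THE INTERFACE'S `LFData` FOR THE v3 DATUM**: region histories := the lane's discrete histories; `trivReg := Hist.triv`; `assemble r v := r` (dummy fibre variable —
the fields `(V_i)_{i<j}` of (41) are integrated out inside the pinned masses); `wt r v W := wtP_j(r, W)` (windowed, pinned); `LargeP r i := P_i(r)` for admissible `r`
and `i < j`, else `∅`. [cite: Balaban1985UV3, (38)-(41) p.266] -/
def AlphaInputsT3AC.OfV3At.lfDataT3v3 : LFData (h.dataT3v3 hc γ hγ hγ1 π) where
  Reg := fun K j => Hist (F.P K) j
  regFintype := fun _ _ => inferInstance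
  trivReg := fun K j => Hist.triv (F.P K) j
  assemble := fun _ _ r _ => r
  wt := fun K j r _ W => (h.pkgAtV3 hc γ hγ hγ1 K).wtP j r W
  LargeP := fun K j r i =>
    if hij : i < j ∧ Hist.Admissible 𝔠.lane.carrier.M₁
        (rcolOf (T3Scales F γ hγ (hγ1.trans (sq_min_one_le _ 𝔠.gamma0_pos)) K) 𝔠.lane.carrier) j r
    then r ⟨i, hij.1⟩ else ∅

/-- The weight of `lfDataT3v3` is the windowed pinned weight (definitional). [cite: Balaban1985UV3, (41) p.266] -/
theorem AlphaInputsT3AC.OfV3At.lfDataT3v3_wt_eq (K j : ℕ) (r : Hist (F.P K) j)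
    (v : (i : Fin j) → GaugeField (F.P K) i (Matrix.specialUnitaryGroup (Fin 2) ℂ)) (W : GaugeField (F.P K) j (Matrix.specialUnitaryGroup (Fin 2) ℂ)) :
    (h.lfDataT3v3 hc γ hγ hγ1 π).wt K j r v W = (h.pkgAtV3 hc γ hγ hγ1 K).wtP j r W := rfl

/-- The assembled history is the region history itself (definitional). [cite: Balaban1985UV3, (38) p.266] -/
theorem AlphaInputsT3AC.OfV3At.lfDataT3v3_assemble_eq (K j : ℕ) (r : Hist (F.P K) j)
    (v : (i : Fin j) → GaugeField (F.P K) i (Matrix.specialUnitaryGroup (Fin 2) ℂ)) :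
    (h.lfDataT3v3 hc γ hγ hγ1 π).assemble K j r v = r := rfl

/-- **`LFSum` FOR THE v3 DATUM — PROVED**: `wt ≥ 0`, the trivial region history assembles to the trivial history, and `LF_j(W)[Φ] = Σ_r ∫ wt(r, v, W)·e^{Φ(assemble r v)} dv`
(integrand constant in the dummy fibre variable, `dv` a probability measure). [cite: Balaban1985UV3, (41) p.266] -/
theorem AlphaInputsT3AC.OfV3At.dataT3v3_lfSum : LFSum (h.dataT3v3 hc γ hγ hγ1 π) (h.lfDataT3v3 hc γ hγ hγ1 π) := by
  refine ⟨fun K j r v W => h.wtP_nonneg hc γ hγ hγ1 K j r W, fun K j v => rfl, fun K j W Φ => ?_⟩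
  show ∑ r : Hist (F.P K) j, (h.pkgAtV3 hc γ hγ hγ1 K).wtP j r W * Real.exp (Φ r) =
    ∑ r : Hist (F.P K) j, ∫ _v, (h.pkgAtV3 hc γ hγ hγ1 K).wtP j r W * Real.exp (Φ r)
      ∂Measure.pi fun i : Fin j => fieldMeasure (F.P K) (i : ℕ) (Matrix.specialUnitaryGroup (Fin 2) ℂ)
  refine Finset.sum_congr rfl fun r _ => ?_
  rw [integral_const, smul_eq_mul]
  simp

/-- The weight vanishes on inadmissible region histories. [cite: Balaban1985UV3, pp.267-268] -/
theorem AlphaInputsT3AC.OfV3At.lfDataT3v3_wt_eq_zero_of_not_admissible (K j : ℕ) (r : Hist (F.P K) j)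
    (hr : ¬ Hist.Admissible 𝔠.lane.carrier.M₁
      (rcolOf (T3Scales F γ hγ (hγ1.trans (sq_min_one_le _ 𝔠.gamma0_pos)) K) 𝔠.lane.carrier) j r)
    (v : (i : Fin j) → GaugeField (F.P K) i (Matrix.specialUnitaryGroup (Fin 2) ℂ)) (W : GaugeField (F.P K) j (Matrix.specialUnitaryGroup (Fin 2) ℂ)) :
    (h.lfDataT3v3 hc γ hγ hγ1 π).wt K j r v W = 0 :=
  h.wtP_eq_zero_of_not_admissible hc γ hγ hγ1 K j r W hr

/-- **The weight is supported in `Adm`** (`1 ≤ j ≤ K`, every region history, pointwise). [cite: Balaban1985UV3, (40)–(41) p.266] -/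
theorem AlphaInputsT3AC.OfV3At.lfDataT3v3_adm_of_wt_ne_zero (K j : ℕ) (hj1 : 1 ≤ j) (hj : j ≤ K) (r : Hist (F.P K) j)
    (v : (i : Fin j) → GaugeField (F.P K) i (Matrix.specialUnitaryGroup (Fin 2) ℂ)) (W : GaugeField (F.P K) j (Matrix.specialUnitaryGroup (Fin 2) ℂ))
    (hW : (h.lfDataT3v3 hc γ hγ hγ1 π).wt K j r v W ≠ 0) :
    (h.dataT3v3 hc γ hγ hγ1 π).Adm K j ((h.lfDataT3v3 hc γ hγ hγ1 π).assemble K j r v) W :=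
  h.adm_of_wtP_ne_zero hc γ hγ hγ1 π K j hj1 hj r W hW

/-- `LargeP K j r i = ∅` for `j ≤ i`. [cite: Balaban1985UV3, (38) p.266] -/
theorem AlphaInputsT3AC.OfV3At.lfDataT3v3_largeP_of_le (K j : ℕ) (r : Hist (F.P K) j) (i : ℕ) (hi : j ≤ i) :
    (h.lfDataT3v3 hc γ hγ hγ1 π).LargeP K j r i = ∅ := by
  dsimp only [AlphaInputsT3AC.OfV3At.lfDataT3v3]
  rw [dif_neg]
  exact fun hij => absurd hij.1 (not_lt.mpr hi)

/-- … and `∅` for inadmissible region histories. [cite: Balaban1985UV3, pp.267-268] -/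
theorem AlphaInputsT3AC.OfV3At.lfDataT3v3_largeP_of_not_admissible (K j : ℕ) (r : Hist (F.P K) j)
    (hr : ¬ Hist.Admissible 𝔠.lane.carrier.M₁
      (rcolOf (T3Scales F γ hγ (hγ1.trans (sq_min_one_le _ 𝔠.gamma0_pos)) K) 𝔠.lane.carrier) j r) (i : ℕ) :
    (h.lfDataT3v3 hc γ hγ hγ1 π).LargeP K j r i = ∅ := by
  dsimp only [AlphaInputsT3AC.OfV3At.lfDataT3v3]
  rw [dif_neg]
  exact fun hij => hr hij.2

/-- For an admissible region history and `i < j`, `LargeP K j r i = P_i(r)`. [cite: Balaban1985UV3, (38) p.266] -/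
theorem AlphaInputsT3AC.OfV3At.lfDataT3v3_largeP_of_admissible (K j : ℕ) (r : Hist (F.P K) j)
    (hr : Hist.Admissible 𝔠.lane.carrier.M₁
      (rcolOf (T3Scales F γ hγ (hγ1.trans (sq_min_one_le _ 𝔠.gamma0_pos)) K) 𝔠.lane.carrier) j r) (i : ℕ) (hi : i < j) :
    (h.lfDataT3v3 hc γ hγ hγ1 π).LargeP K j r i = r ⟨i, hi⟩ := by
  dsimp only [AlphaInputsT3AC.OfV3At.lfDataT3v3]
  rw [dif_pos ⟨hi, hr⟩]

/-- Below the top index the v3 datum's `Λ_i(h)` IS the lane's `Carriers.Lam`. [cite: Balaban1985UV3, (40)-(42) p.266] -/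
theorem AlphaInputsT3AC.OfV3At.dataT3v3_Λ_eq_Lam (K j : ℕ) (r : Hist (F.P K) j) (i : ℕ) (hi : i < j) :
    (h.dataT3v3 hc γ hγ hγ1 π).Λ K j r i =
      Lam 𝔠.lane.carrier.M₁ (rcolOf (T3Scales F γ hγ (hγ1.trans (sq_min_one_le _ 𝔠.gamma0_pos)) K) 𝔠.lane.carrier) r i := by
  show lam42 _ j i = _
  rw [lam42_of_lt hi]
  rfl

/-- **`LargePSpec`, GEOMETRIC HALF, FOR `lfDataT3v3` — PROVED**: `p′ ∈ LargeP K j r i`, `j ≤ K` ⇒ `i < j` and `p′ ∈ plaqsIn i (Λ_i(assemble r v))`.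
[cite: Balaban1985UV3, (67) p.273] -/
theorem AlphaInputsT3AC.OfV3At.lfDataT3v3_largeP_geom (K j : ℕ) (hj : j ≤ K) (r : Hist (F.P K) j)
    (v : (i : Fin j) → GaugeField (F.P K) i (Matrix.specialUnitaryGroup (Fin 2) ℂ)) (i : ℕ) (p' : Plaq (F.P K) i)
    (hp : p' ∈ (h.lfDataT3v3 hc γ hγ hγ1 π).LargeP K j r i) :
    i < j ∧ p' ∈ plaqsIn i ((h.dataT3v3 hc γ hγ hγ1 π).Λ K j ((h.lfDataT3v3 hc γ hγ hγ1 π).assemble K j r v) i) := by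
  by_cases hij : i < j ∧ Hist.Admissible 𝔠.lane.carrier.M₁
      (rcolOf (T3Scales F γ hγ (hγ1.trans (sq_min_one_le _ 𝔠.gamma0_pos)) K) 𝔠.lane.carrier) j r
  · rw [h.lfDataT3v3_largeP_of_admissible hc γ hγ hγ1 π K j r hij.2 i hij.1] at hp
    refine ⟨hij.1, ?_⟩
    rw [h.lfDataT3v3_assemble_eq hc γ hγ hγ1 π, h.dataT3v3_Λ_eq_Lam hc γ hγ hγ1 π K j r i hij.1, mem_plaqsIn_iff]
    have hiK : i ≤ (F.P K).m + (F.P K).K := by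
      show i ≤ F.m + K
      omega
    exact (cornerSet_subset_plaqCover hiK p').trans (plaqCover_subset_Lam_of_admissible _ _ j r hij.2 i hij.1 p' hp)
  · exfalso
    have h0 : (h.lfDataT3v3 hc γ hγ hγ1 π).LargeP K j r i = ∅ := by
      dsimp only [AlphaInputsT3AC.OfV3At.lfDataT3v3]
      rw [dif_neg hij]
    rw [h0] at hp
    simp at hp

/-! ## §4 v5p5's STUB 2‴ as a theorem for the v3 socket -/

/-- **v5p5's `stub_windowedWeights` FOR THE v3 SOCKET — PROVED, UNCONDITIONALLY IN `h : OfV3At`** (owner ruling g18-№3 §3 (iv)): the stub's text with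
`OfV2At ↦ OfV3At`, `dataT3c ↦ dataT3v3` and the (w2) guard `1 ≤ j` (F-α1-9), witnessed by `wt′ K j r := wtP_j(r, ·)` (print's windowed PINNED weights), `γw := 1`,
`Bm := 1`: (w0) `wt′ ≥ 0`; (w1) `wt′ = 0` on inadmissible histories; (w2) for `1 ≤ j ≤ K`, a.e. (indeed pointwise) `wt′ ≠ 0 ⇒ Adm`; (e′) `Integrable ∧ ∫ ≤ Bm = 1`,
uniformly in the cut-off; (e″) `Pint_j(r, ·)` measurable; (iv) `Ineq41AE` and `Integrable up` for the datum with `LF` rewritten through `wt′`.  No coupling threshold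
(`γ ≤ γw` idle), no `7 ≤ L` needed (idle).  [cite: Balaban1985UV3, (1) p.256, (40)–(41) p.266, (47)–(48) p.267, (55) p.269 and Thm 2 p.272] -/
theorem AlphaInputsT3AC.windowedWeights_v3 :
    ∀ (L : ℕ), Odd L → 7 ≤ L →
      ∀ (𝔠 : AlphaConsts L (suGroupModel 2).N) (a₀ a₁ : ℝ), 0 < a₀ → 0 < a₁ → 𝔠.B₃ * a₁ ≤ a₀ →
        ∃ (γw Bm : ℝ), 0 < γw ∧ 0 ≤ Bm ∧
          ∀ (F : T3Family) (hF : F.L = L) (h : AlphaInputsT3AC.OfV3At F (hF ▸ 𝔠) a₀ a₁)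
            (hc : 0 < a₀ ∧ 0 < a₁ ∧ (hF ▸ 𝔠).B₃ * a₁ ≤ a₀) (γ : ℝ) (hγ : 0 < γ) (hγ1 : γ ≤ (min (hF ▸ 𝔠).gamma0 1) ^ 2)
            (π : AlphaInputsT3AC.PolymerT3 F), γ ≤ γw →
            ∃ wt' : (K j : ℕ) → Hist (F.P K) j → GaugeField (F.P K) j (Matrix.specialUnitaryGroup (Fin 2) ℂ) → ℝ,
              (∀ K j r Wf, 0 ≤ wt' K j r Wf) ∧
              (∀ (K j : ℕ) (r : Hist (F.P K) j) Wf,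
                ¬ Hist.Admissible (hF ▸ 𝔠).lane.carrier.M₁
                  (rcolOf (T3Scales F γ hγ (hγ1.trans (sq_min_one_le _ (hF ▸ 𝔠).gamma0_pos)) K) (hF ▸ 𝔠).lane.carrier) j r →
                wt' K j r Wf = 0) ∧
              (∀ (K j : ℕ) (r : Hist (F.P K) j), 1 ≤ j → j ≤ K →
                ∀ᵐ Wf ∂fieldMeasure (F.P K) j (Matrix.specialUnitaryGroup (Fin 2) ℂ),
                  wt' K j r Wf ≠ 0 → (h.dataT3v3 hc γ hγ hγ1 π).Adm K j r Wf) ∧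
              (∀ (K j : ℕ) (r : Hist (F.P K) j), j ≤ K →
                Integrable (wt' K j r) (fieldMeasure (F.P K) j (Matrix.specialUnitaryGroup (Fin 2) ℂ)) ∧
                ∫ Wf, wt' K j r Wf ∂fieldMeasure (F.P K) j (Matrix.specialUnitaryGroup (Fin 2) ℂ) ≤ Bm) ∧
              (∀ (K j : ℕ) (r : Hist (F.P K) j), j ≤ K →
                Measurable fun Wf : GaugeField (F.P K) j (Matrix.specialUnitaryGroup (Fin 2) ℂ) => (h.dataT3v3 hc γ hγ hγ1 π).Pint K j r Wf) ∧
              (∀ (K j : ℕ), j ≤ K →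
                Ineq41AE ({ h.dataT3v3 hc γ hγ hγ1 π with
                    LF := fun K j Wf Φ => wt' K j (Hist.triv (F.P K) j) Wf * Real.exp (Φ (Hist.triv (F.P K) j)) +
                      ∑ r ∈ Finset.univ.erase (Hist.triv (F.P K) j), wt' K j r Wf * Real.exp (Φ r) } : AlphaDataT3 F γ) K j ∧
                Integrable (AlphaDataT3.up ({ h.dataT3v3 hc γ hγ hγ1 π with
                    LF := fun K j Wf Φ => wt' K j (Hist.triv (F.P K) j) Wf * Real.exp (Φ (Hist.triv (F.P K) j)) +
                      ∑ r ∈ Finset.univ.erase (Hist.triv (F.P K) j), wt' K j r Wf * Real.exp (Φ r) } : AlphaDataT3 F γ) K j)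
                  (fieldMeasure (F.P K) j (Matrix.specialUnitaryGroup (Fin 2) ℂ))) := by
  intro L _ _ 𝔠 a₀ a₁ _ _ _
  refine ⟨1, 1, one_pos, zero_le_one, ?_⟩
  intro F hF
  subst hF
  intro h hc γ hγ hγ1 π _
  exact ⟨fun K j r => (h.pkgAtV3 hc γ hγ hγ1 K).wtP j r,
    fun K j r Wf => h.wtP_nonneg hc γ hγ hγ1 K j r Wf,
    fun K j r Wf hr => h.wtP_eq_zero_of_not_admissible hc γ hγ hγ1 K j r Wf hr,
    fun K j r hj1 hj => ae_of_all _ fun Wf hW => h.adm_of_wtP_ne_zero hc γ hγ hγ1 π K j hj1 hj r Wf hW,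
    fun K j r _ => h.integrable_wtP_and_integral_le hc γ hγ hγ1 K j r,
    fun K j r hj => h.dataT3v3_measurable_Pint hc γ hγ hγ1 π K j hj r,
    fun K j hj => ⟨h.dataT3v3P_ineq41AE hc γ hγ hγ1 π K j hj, h.dataT3v3P_integrable_up hc γ hγ hγ1 π K j hj⟩⟩

end Summit.QuantumFields.YangMills.Theorems

end
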